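import Summits.BirchSwinnertonDyer.BirchSwinnertonDyer.Theorems.ErratumRoadFiveBigRepArithInputs
import Summits.BirchSwinnertonDyer.Rank1Residual.X11b.AnticyclotomicEmbedding
import Literature.NumberTheory.EllipticCurves.BSDSelmerCMPConverseHeegnerFieldProofs
import HarnessLib

/-!
# K2 crux 19270 `IMCDivAtErratumDataAll` (H3♭), ROAD FF — the last two ARITHMETIC inputs of Lemma
# 2.1 at the erratum data, in the Galois-module currency of the glue: `E(K)[p] = 0` from the
# irreducibility of `E[p]` (global), and `E(K_𝔭)[p] = 0` from (iv) `E(ℚ_p)[p] = 0` (local at the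
# strict prime, `K_𝔭 = ℚ_p`) — GALOIS DESCENT for geometric torsion points

Cell `bsd-stepL`, seat `bsd-stepL-imc-p1` (g8). `--supports stmt-BirchSwinnertonDyer-19270 --as helper`.
HONEST FRAMING: BSD is not proved for any pair by this file; it closes no item; no definition, no
named fact, no `sorry`. Sequel of p479748 ∕ p480662 ∕ p481719 ∕ p483719 (same seat, same night).

## What this file proves

p481719's `hglob_anticyclotomicBigRep` and `hloc_anticyclotomicBigRep` take their torsion inputs in
the language of GEOMETRIC points: "no nonzero `Γ_K`-fixed `P ∈ E(K̄)` with `p P = O`" and "no nonzero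
`Γ_{K_𝔭}`-fixed (through `absGaloisRestrict K K_𝔭`) `P ∈ E(K̄)` with `p P = O`". The erratum's
hypotheses are RATIONAL-point statements: `E(K)[p] = 0` (⟸ irreducibility of `ρ̄_{E,p}`, a quadratic
`K`: the tree's `torsionBy_eq_bot_of_isImaginaryQuadratic_of_hasIrreducibleModPGaloisRep`) and (iv)
`E(ℚ_p)[p] = 0` (the A′-hypothesis, `X11.AprimeLocusAt`). This file is the Galois descent between them:

* §1 **`eq_zero_of_forall_smul_eq_of_rational`** — for any `W'/K` (`K` perfect): a `Γ_K`-fixed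
  geometric `n`-torsion point vanishes if `W'` has no nonzero `K`-rational `n`-torsion (the tree's
  discharged descent `fixedPoints_eq_range_map_holds`, `E(K̄)^{Γ_K} = E(K)`, plus injectivity of
  base change); **`eq_zero_of_forall_absGaloisRestrict_smul_eq`** — for any `K`-field `E` of
  characteristic `0` (a completion `K_𝔭`): a geometric `n`-torsion point of `W'/K` fixed by `Γ_E`
  acting through the chosen restriction `absGaloisRestrict K E : Γ_E → Γ_K` (defn-ty1's
  `localMap K (Sum.inl 𝔭)`) vanishes if `W'` has no nonzero `E`-rational `n`-torsion: push `P` to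
  `E(K̄_E)` along the chosen embedding (`pointsMapOfEmb`, equivariant for `res_ι = absGaloisRestrict`
  by p483719's `resGalOfEmb_absClosureEmbedding_eq`), where it is `Γ_E`-fixed, and descend over `E`.
* §2 **transfer to `ℚ_p`**: `forall_torsion_eq_zero_of_ringHom_padic` (no `n`-torsion over `ℚ_p` ⇒ none
  over any `F ↪ ℚ_p`, Mathlib `Point.map_injective`), `forall_torsion_eq_zero_baseChange_baseChange`
  (`(W⁄K)⁄F = W⁄F`, Mathlib `map_baseChange`), **`nonempty_ringHom_adicCompletion_padic`** (`K_𝔭 ≃ ℚ_p`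
  at a degree-one prime `𝔭 ∣ p`: the tree's `adicCompletionEquivOfDegreeOne` + Mathlib
  `Padic.adicCompletionEquiv`, as in multr1-p1's `embAt`), and the LOCAL input
  **`hdec_geomPoints_of_padicTorsion`**: (iv) `∀ Q ∈ E(ℚ_p), pQ = O → Q = O` ⟹ no nonzero
  `Γ_{K_𝔭}`-fixed geometric `p`-torsion of `E_K` — the hypothesis `h𝔮` of `hloc_anticyclotomicBigRep`.
* §3 the GLOBAL input **`hglob_geomPoints_of_irr`**: `Irr(E[p])` + `K` imaginary quadratic ⟹ no nonzero
  `Γ_K`-fixed geometric `p`-torsion of `E_K` — the hypothesis `hK` of `hglob_anticyclotomicBigRep`.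
* §4 **`hglob_anticyclotomicBigRep_of_irr`**, **`hloc_anticyclotomicBigRep_of_aprime`**: p481719's
  `hglob`/`hloc` for `M_f = (W.baseChange K).anticyclotomicBigRep p κ` with ALL arithmetic inputs
  discharged from the erratum's binders (`Irr W p`, (iv), good reduction outside `Σ ∪ S_p`, a
  degree-one `𝔭 ∣ p`) — the form the assembly consumes.

Pure bookkeeping on tree objects; CONDITIONAL on nothing; closes nothing.

References: [Castella2018Erratum] Thm. 1.1 (iii)–(iv), Lemma 2.1 and its proof (pp. 1–2); [Castella2018]
§2.2 (`K_𝔭 = ℚ_p`); [SilvermanAEC2009] I.§1, VIII.§1 (Galois descent `E(K̄)^{Γ_K} = E(K)`);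
[Skinner2020AnnMath] Lemma 2.8.1; [GrossLMS1991] §2 (`E(K)[p] = 0` from irreducibility);
[FrohlichTaylor1990] III (1.14)(a) (completions at degree-one primes).
-/

noncomputable section

open scoped Classical
open Field IsDedekindDomain NumberField
  Literature.NumberTheory.GaloisRepresentations Literature.NumberTheory.EllipticCurves WeierstrassCurve

universe u

namespace Summit.BirchSwinnertonDyer.Rank1Residual.X11b.BigRep

/-! ### §1 Galois descent for fixed geometric torsion points -/

section Descent

variable {K : Type u} [Field K] (W' : WeierstrassCurve K)

/-- **Descent over the base**: a `Γ_K`-fixed geometric point `P ∈ E(K̄)` with `n P = O` vanishes when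
`E` has no nonzero `K`-rational `n`-torsion (`E(K̄)^{Γ_K} = E(K)`, the tree's
`fixedPoints_eq_range_map_holds`, and injectivity of base change). [cite: SilvermanAEC2009, I.§1 and VIII.§1 (proof of Prop. 1.2)] -/
theorem eq_zero_of_forall_smul_eq_of_rational [PerfectField K] {n : ℕ}
    (hK : ∀ Q : (W'.baseChange K).toAffine.Point, n • Q = 0 → Q = 0)
    (P : W'.geomPoints) (hP : ∀ σ : absoluteGaloisGroup K, σ • P = P) (hn : n • P = 0) : P = 0 := by
  have hR : P ∈ MulAction.fixedPoints (absoluteGaloisGroup K) W'.geomPoints := hP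
  rw [W'.fixedPoints_eq_range_map_holds] at hR
  obtain ⟨P₀, hP₀⟩ := hR
  dsimp only at hP₀
  have hinj : Function.Injective
      (WeierstrassCurve.Affine.Point.baseChange (W' := W') K (AlgebraicClosure K)) :=
    WeierstrassCurve.Affine.Point.map_injective _
  have hn₀ : n • P₀ = 0 := by
    apply hinj
    rw [map_nsmul, map_zero]
    have : n • (WeierstrassCurve.Affine.Point.baseChange (W' := W') K (AlgebraicClosure K) P₀ :
      W'.geomPoints) = 0 := by rw [hP₀]; exact hn
    exact this
  rw [← hP₀, hK P₀ hn₀, map_zero]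
  rfl

variable (E : Type u) [Field E] [Algebra K E]

/-- The identification `E(K̄_E)` (`localPoints W' E`, the tree's local coefficient module) `=`
`(W'⁄E)(K̄_E)` (`geomPoints (W'.baseChange E)`) — definitional (`(W'⁄K̄_E) = (W'⁄E)⁄K̄_E` by `rfl`).
[cite: SilvermanAEC2009, VIII.§1 (E(K̄) for the base-changed curve)] -/
theorem localPoints_eq_geomPoints_baseChange : localPoints W' E = (W'.baseChange E).geomPoints := rfl

/-- Reading a local point as a geometric point of the base-changed curve (the identity map across the
definitional equality `localPoints_eq_geomPoints_baseChange`) is `Γ_E`-equivariant: the two actions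
(`restrictScalars K σ` on `W'⁄K̄_E`, `σ` on `(W'⁄E)⁄K̄_E`) agree point by point. [cite: SilvermanAEC2009, VIII.§1] -/
theorem smul_eq_smul_geomPoints (σ : absoluteGaloisGroup E) (Q : localPoints W' E) :
    @id (W'.baseChange E).geomPoints (σ • Q) = σ • @id (W'.baseChange E).geomPoints Q := by
  change WeierstrassCurve.Affine.Point.map
      ((AlgEquiv.restrictScalars K (show AlgebraicClosure E ≃ₐ[E] AlgebraicClosure E from σ) :
          AlgebraicClosure E ≃ₐ[K] AlgebraicClosure E) :
        AlgebraicClosure E →ₐ[K] AlgebraicClosure E) Q =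
    WeierstrassCurve.Affine.Point.map
      ((show AlgebraicClosure E ≃ₐ[E] AlgebraicClosure E from σ) :
        AlgebraicClosure E →ₐ[E] AlgebraicClosure E) (@id (W'.baseChange E).geomPoints Q)
  rcases Q with _ | ⟨x, y, h⟩
  · rfl
  · rfl

/-- **Descent at a decomposition group.** For a `K`-field `E` of characteristic `0` (a completion
`K_𝔭`), a geometric `n`-torsion point `P ∈ E(K̄)` fixed by `Γ_E` acting through the chosen restriction
`absGaloisRestrict K E : Γ_E → Γ_K` (defn-ty1's `localMap K (Sum.inl ·)`, whose image is the
decomposition group `GreenbergSelmer.decomp`) vanishes if `E` has no nonzero `E`-rational `n`-torsion: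
push `P` to `E(K̄_E)` along the chosen embedding (`pointsMapOfEmb`; equivariant because
`res_ι = absGaloisRestrict`, `resGalOfEmb_absClosureEmbedding_eq`), where it is `Γ_E`-fixed, and
descend over `E` (`eq_zero_of_forall_smul_eq_of_rational`). This is "`H⁰(K_𝔭, E[p]) = E(K_𝔭)[p]`".
[cite: Castella2018Erratum, Lemma 2.1, proof (p. 2: "vanishes when so does H⁰(K_𝔭, A_g[ϖ])")]
[cite: SilvermanAEC2009, VIII.§1 (Galois descent)] -/
theorem eq_zero_of_forall_absGaloisRestrict_smul_eq [CharZero E] {n : ℕ}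
    (hE : ∀ Q : (W'.baseChange E).toAffine.Point, n • Q = 0 → Q = 0)
    (P : W'.geomPoints) (hP : ∀ σ : absoluteGaloisGroup E, absGaloisRestrict K E σ • P = P)
    (hn : n • P = 0) : P = 0 := by
  haveI : PerfectField E := PerfectField.ofCharZero
  set ι := absClosureEmbedding K E with hι
  set Q : localPoints W' E := pointsMapOfEmb W' ι P with hQ
  -- `Q` is `Γ_E`-fixed
  have hQfix : ∀ σ : absoluteGaloisGroup E, σ • Q = Q := fun σ => by
    rw [hQ, ← pointsMapOfEmb_smul, resGalOfEmb_absClosureEmbedding_eq E σ, hP σ]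
  -- read `Q` in `(W'⁄E)(K̄_E)`: still fixed, still `n`-torsion, so zero by descent over `E`
  have hfix : ∀ σ : absoluteGaloisGroup E,
      σ • @id (W'.baseChange E).geomPoints Q = @id (W'.baseChange E).geomPoints Q := fun σ => by
    rw [← smul_eq_smul_geomPoints, hQfix σ]
  have hnQ : n • Q = 0 := by rw [hQ, ← map_nsmul, hn, map_zero]
  have hQ0 : @id (W'.baseChange E).geomPoints Q = 0 :=
    eq_zero_of_forall_smul_eq_of_rational (W'.baseChange E) hE _ hfix hnQ
  exact pointsMapOfEmb_injective W' ι (by rw [← hQ, map_zero]; exact hQ0)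

end Descent

/-! ### §2 Transfer to `ℚ_p` and the LOCAL input from (iv) -/

section Local

variable (W : WeierstrassCurve ℚ) (p : ℕ) [Fact p.Prime]

/-- **No `n`-torsion over `ℚ_p` ⟹ none over any field `F ↪ ℚ_p`** (the map on points along
`φ : F → ℚ_p` is an injective homomorphism, Mathlib `Point.map_injective`). [cite: SilvermanAEC2009, VII.§3 (points over a subfield inject)] -/
theorem forall_torsion_eq_zero_of_ringHom_padic {F : Type u} [Field F] [CharZero F] (φ : F →+* ℚ_[p])
    {n : ℕ} (hiv : ∀ Q : (W.baseChange ℚ_[p]).toAffine.Point, n • Q = 0 → Q = 0) :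
    ∀ Q : (W.baseChange F).toAffine.Point, n • Q = 0 → Q = 0 := by
  intro Q hQ
  have hinj := WeierstrassCurve.Affine.Point.map_injective (W' := W) φ.toRatAlgHom
  apply hinj
  rw [map_zero]
  exact hiv _ (by rw [← map_nsmul, hQ, map_zero])

/-- `(W⁄K)⁄F = W⁄F` for a tower `ℚ → K → F` (Mathlib `map_baseChange`): the torsion statement for the
doubly base-changed curve from the one for `W⁄F`. [folklore] -/
theorem forall_torsion_eq_zero_baseChange_baseChange (K : Type u) [Field K] [CharZero K]
    (F : Type u) [Field F] [Algebra K F] [CharZero F] {n : ℕ}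
    (h : ∀ Q : (W.baseChange F).toAffine.Point, n • Q = 0 → Q = 0) :
    ∀ Q : ((W.baseChange K).baseChange F).toAffine.Point, n • Q = 0 → Q = 0 := by
  have hW : (W.baseChange K).baseChange F = W.baseChange F :=
    W.map_baseChange (algebraMap K F).toRatAlgHom
  rw [hW]
  exact h

/-- **`K_𝔭 → ℚ_p` at a degree-one prime `𝔭 ∣ p`** (`e(𝔭|p) = f(𝔭|p) = 1`, e.g. `p` split in a
quadratic `K`): the tree's `adicCompletionEquivOfDegreeOne ℚ K v 𝔭 : ℚ_v ≃+* K_𝔭` inverted and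
composed with Mathlib's `Padic.adicCompletionEquiv : ℚ_[p] ≃ ℚ_v` — the `K_𝔭`-part of multr1-p1's
`embAt`. [cite: FrohlichTaylor1990, Ch. III §1 (1.14)(a)] [cite: Castella2018, §2.2 ("K_𝔭 = ℚ_p")] -/
theorem nonempty_ringHom_adicCompletion_padic (K : Type) [Field K] [NumberField K]
    (𝔭 : HeightOneSpectrum (𝓞 K)) (h𝔭 : ((p : ℕ) : 𝓞 K) ∈ 𝔭.asIdeal)
    (he : 𝔭.asIdeal.ramificationIdx (𝓞 ℚ) = 1) (hf : 𝔭.asIdeal.inertiaDeg (𝓞 ℚ) = 1) :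
    Nonempty (𝔭.adicCompletion K →+* ℚ_[p]) := by
  haveI : 𝔭.asIdeal.LiesOver (ratPlace p).asIdeal := ⟨by rw [← under_eq_ratPlace_of_mem h𝔭]; rfl⟩
  exact ⟨(Padic.adicCompletionEquiv (𝓞 ℚ) ⟨p, Fact.out⟩).symm.toAlgEquiv.toRingEquiv.toRingHom.comp
    (Literature.NumberTheory.Automorphic.adicCompletionEquivOfDegreeOne ℚ K (ratPlace p) 𝔭 he hf).symm.toRingHom⟩

/-- **The LOCAL input of Lemma 2.1 from (iv).** If `E(ℚ_p)` has no nonzero `n`-torsion (`n = p`: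
hypothesis (iv) `E(ℚ_p)[p] = 0` of erratum Thm. 1.1 ∕ `X11.AprimeLocusAt`) and `K_𝔭 ↪ ℚ_p`
(`nonempty_ringHom_adicCompletion_padic`), then NO nonzero geometric `n`-torsion point of `E_K` is
fixed by `Γ_{K_𝔭}` acting through `absGaloisRestrict K K_𝔭` — the hypothesis `h𝔮` of p481719's
`hloc_anticyclotomicBigRep` ("`H⁰(K_𝔭, A_g[ϖ]) = 0` … forced on us", erratum p. 2).
[cite: Castella2018Erratum, Thm. 1.1 (iv) and Lemma 2.1 (pp. 1–2)] [cite: Castella2018, §2.2 ("K_𝔭 = ℚ_p")] -/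
theorem hdec_geomPoints_of_padicTorsion (K : Type u) [Field K] [NumberField K]
    (𝔭 : HeightOneSpectrum (𝓞 K)) (φ : 𝔭.adicCompletion K →+* ℚ_[p]) {n : ℕ}
    (hiv : ∀ Q : (W.baseChange ℚ_[p]).toAffine.Point, n • Q = 0 → Q = 0) :
    ∀ P : (W.baseChange K).geomPoints,
      (∀ σ : absoluteGaloisGroup (𝔭.adicCompletion K),
        absGaloisRestrict K (𝔭.adicCompletion K) σ • P = P) → n • P = 0 → P = 0 := by
  haveI : CharZero (𝔭.adicCompletion K) :=
    charZero_of_injective_algebraMap (algebraMap K (𝔭.adicCompletion K)).injective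
  intro P hP hn
  exact eq_zero_of_forall_absGaloisRestrict_smul_eq (W.baseChange K) (𝔭.adicCompletion K)
    (forall_torsion_eq_zero_baseChange_baseChange W K (𝔭.adicCompletion K)
      (forall_torsion_eq_zero_of_ringHom_padic W p φ hiv)) P hP hn

end Local

/-! ### §3 The GLOBAL input from the irreducibility of `E[p]` -/

section Global

variable {K : Type u} [Field K] [NumberField K] (W : WeierstrassCurve ℚ) [W.IsElliptic]
  (p : ℕ) [Fact p.Prime]

/-- **The GLOBAL input of Lemma 2.1 from irreducibility.** For `E/ℚ` with `E[p]` irreducible and an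
imaginary quadratic `K`, NO nonzero geometric `p`-torsion point of `E_K` is fixed by `Γ_K`
(`E(K)[p] = 0`, the tree's `torsionBy_eq_bot_of_isImaginaryQuadratic_of_hasIrreducibleModPGaloisRep`,
+ descent) — the hypothesis `hK` of p481719's `hglob_anticyclotomicBigRep` ("`H⁰(K, M_g) = … = 0` by …
the irreducibility of `ρ̄_g|_{G_K}`", erratum p. 2; [Ski20, Lemma 2.8.1]).
[cite: Castella2018Erratum, Lemma 2.1, proof (p. 2)] [cite: GrossLMS1991, §2 (E(K)[p] = 0)] -/
theorem hglob_geomPoints_of_irr (hK : IsImaginaryQuadratic K) (hirr : W.HasIrreducibleModPGaloisRep p) :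
    ∀ P : (W.baseChange K).geomPoints,
      (∀ σ : absoluteGaloisGroup K, σ • P = P) → p • P = 0 → P = 0 := by
  refine eq_zero_of_forall_smul_eq_of_rational (W.baseChange K) fun Q hQ => ?_
  have hbot := torsionBy_eq_bot_of_isImaginaryQuadratic_of_hasIrreducibleModPGaloisRep W K hK
    (Fact.out : p.Prime) hirr
  have hmem : (Q : (W.baseChange K).toAffine.Point) ∈
      AddSubgroup.torsionBy (W.baseChange K).toAffine.Point (p : ℤ) :=
    (Submodule.mem_torsionBy_iff (p : ℤ) _).2 (by rw [natCast_zsmul]; exact hQ)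
  rw [hbot] at hmem
  exact hmem

end Global

/-! ### §4 `hglob` ∕ `hloc` for `M_f` with the arithmetic inputs discharged -/

section Assembly

variable {K : Type u} [Field K] [NumberField K] (W : WeierstrassCurve ℚ) [W.IsElliptic]
  (p : ℕ) [Fact p.Prime] [TopologicalSpace (PowerSeries ℤ_[p])]
  [ContinuousSMul (PowerSeries ℤ_[p]) (BigRepModule ℤ_[p] p (PrimaryTorsion (W.baseChange K).geomPoints p))]

/-- **`hglob` of the glue for `M_f = T_pE_K ⊗ Λ^*`, ALL inputs discharged**: for `E/ℚ` with `E[p]`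
irreducible, an imaginary quadratic `K` and any `ℤ_p`-extension `κ` of `K`, the global invariants of
`(W.baseChange K).anticyclotomicBigRep p κ` vanish (hence are `p^m`-divisible).
[cite: Castella2018Erratum, Lemma 2.1, proof (p. 2: "H⁰(K, M_g) = H⁰(K_∞, A_g) = 0")] -/
theorem hglob_anticyclotomicBigRep_of_irr (κ : ZpExtension K p) (hK : IsImaginaryQuadratic K)
    (hirr : W.HasIrreducibleModPGaloisRep p) :
    ∀ m : ℕ, 1 ≤ m → ∀ x ∈ ((W.baseChange K).anticyclotomicBigRep p κ).toTopRep.ρ.invariants,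
      ∃ x' ∈ ((W.baseChange K).anticyclotomicBigRep p κ).toTopRep.ρ.invariants,
        (PowerSeries.C (p : ℤ_[p]) : PowerSeries ℤ_[p]) ^ m • x' = x :=
  hglob_anticyclotomicBigRep (W.baseChange K) κ (hglob_geomPoints_of_irr W p hK hirr)

/-- **`hloc` of the glue for `M_f = T_pE_K ⊗ Λ^*` at `(localMap K, strictSet p 𝔭 Σ)`, ALL inputs
discharged from the erratum's binders**: (iv) `E(ℚ_p)[p] = 0` and `K_𝔭 ↪ ℚ_p` (a degree-one
`𝔭 ∣ p`, `nonempty_ringHom_adicCompletion_padic`) for the strict prime; good reduction of `E_K` at every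
`w ∉ Σ` for the inertia indices (p483719's `hunr_primaryTorsionGaloisRep_of_hasGoodReductionAt`);
divisibility of `E(K̄)` (the tree's DISCHARGED `zsmul_geomPoints_surjective_holds`).
[cite: Castella2018Erratum, Thm. 1.1 (iv), Lemma 2.1 and its proof (pp. 1–2)] -/
theorem hloc_anticyclotomicBigRep_of_aprime (κ : ZpExtension K p) (𝔭 : HeightOneSpectrum (𝓞 K))
    (φ : 𝔭.adicCompletion K →+* ℚ_[p]) (S : Set (HeightOneSpectrum (𝓞 K)))
    (hiv : ∀ Q : (W.baseChange ℚ_[p]).toAffine.Point, p • Q = 0 → Q = 0)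
    (hS : ∀ w : HeightOneSpectrum (𝓞 K), w ∉ S → (W.baseChange K).HasGoodReductionAt w) :
    ∀ m : ℕ, 1 ≤ m → ∀ v ∈ BigGaloisRep.strictSet p 𝔭 S,
      ∀ x ∈ ((((W.baseChange K).anticyclotomicBigRep p κ).restrict
        (BigGaloisRep.localMap K v)).toTopRep).ρ.invariants,
        ∃ x' ∈ ((((W.baseChange K).anticyclotomicBigRep p κ).restrict
          (BigGaloisRep.localMap K v)).toTopRep).ρ.invariants,
          (PowerSeries.C (p : ℤ_[p]) : PowerSeries ℤ_[p]) ^ m • x' = x :=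
  hloc_anticyclotomicBigRep (W.baseChange K) κ 𝔭 S
    (fun P => by
      obtain ⟨Q, hQ⟩ := (W.baseChange K).zsmul_geomPoints_surjective_holds
        (n := (p : ℤ)) (by exact_mod_cast (Fact.out : p.Prime).ne_zero) P
      exact ⟨Q, by rw [← natCast_zsmul]; exact hQ⟩)
    (hdec_geomPoints_of_padicTorsion W p K 𝔭 φ hiv)
    (hunr_primaryTorsionGaloisRep_of_hasGoodReductionAt (W.baseChange K) p S hS)

end Assembly

end Summit.BirchSwinnertonDyer.Rank1Residual.X11b.BigRep

end
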